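import Summits.Langlands.Langlands.Statement
import Literature.NumberTheory.Automorphic.GL2RSLFactorUnramified
import Literature.NumberTheory.Automorphic.GL2UnramifiedLFactorDivisibility
import HarnessLib

/-!
# Line `Sketch` for the crux `ReciprocityUpToIrreducibility` (item stmt-Langlands-14328), continuation c6:
# stub S1 — the `GL_n × GL₁` Rankin–Selberg zeta integral against a constant is the corner-torus integral

Support file (closes nothing; continuation lead c6, wave N6', stub S1
`stub_rsZeta_fin_one_eq_integral_corner`).

For a non-archimedean local field `F`, `1 < n`, a Haar measure `μ'` on `Fˣ` and the measure `ν` on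
`GL₁(F) ⧸ U₁` transported from `μ'` along `a ↦ diag(a) U₁`
(`∫ f dν = ∫_{Fˣ} f(diag(a) U₁) dμ'(a)`, as produced by `exists_haar_measure_quotient_fin_one`), the
JPSS zeta integral `Ψ(s; W, W') = ∫ rsKernel dν` of ANY `W : GL_n(F) → ℂ` against a CONSTANT
`W' = κ` on `GL₁(F)` is the torus integral over the `GL₁`-corner
`∫_{Fˣ} W(diag(a, 1_{n-1})) κ |a|^{s - (n-1)/2} dμ'(a)`:
since `U₁ = 1` the kernel is the honest integrand (`rsKernel_mk_of_fin_one`), which at `diag(a)` is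
`W(diag(a⁻¹, 1)) κ |a⁻¹|^{s-(n-1)/2}` (`rsIntegrand_glDiagonal_fin_one_corner`), and `a ↦ a⁻¹`
preserves `μ'` (`isInvInvariant_of_isHaarMeasure_units`, `integral_inv_eq_self`).  This is the
rank-`n` form of `rsZeta_eq_integral_torus` (`WhittakerTorusJacquetGL2`, `n = 2`).
(Jacquet–Piatetski-Shapiro–Shalika 1983, §2.4 with `m = 1`; Cogdell 2004, §6.1.)  No definitions;
std axioms.
-/

open scoped MatrixGroups Matrix NumberField Classical Polynomial NNReal
open Filter IsDedekindDomain Field Polynomial MeasureTheory Literature.NumberTheory.Automorphic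
  Literature.NumberTheory.GaloisRepresentations Literature.NumberTheory.PAdicHodge Summit.Langlands

noncomputable section
set_option linter.dupNamespace false -- project-wide option (lakefile weak.linter.dupNamespace); `Summit.Langlands.Langlands` is the mandated namespace

namespace Summit.Langlands.Langlands.Theorems.ReciprocityUpToIrreducibility

/-- **The `GL_n × GL₁` Rankin–Selberg integrand at a `1 × 1` diagonal matrix** (`1 < n`):
`rsIntegrand W W' s (diag a) = W(diag(a⁻¹, 1_{n-1})) W'(diag a⁻¹) |a⁻¹|^{s - (n-1)/2}`
(rank-`n` form of `rsIntegrand_glDiagonal_fin_one`). [folklore] -/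
theorem rsIntegrand_glDiagonal_fin_one_corner {F : Type*} [Field F] [ValuativeRel F]
    [TopologicalSpace F] [IsNonarchimedeanLocalField F] {n : ℕ} (hn : 1 < n)
    (W : GL (Fin n) F → ℂ) (W' : GL (Fin 1) F → ℂ) (s : ℂ) (a : Fˣ) :
    rsIntegrand hn W W' s (glDiagonal 1 F fun _ => a) =
      W (glCorner F hn.le (glDiagonal 1 F fun _ => a⁻¹)) * W' (glDiagonal 1 F fun _ => a⁻¹) *
        (((IsNonarchimedeanLocalField.normAbs F ((a⁻¹ : Fˣ) : F) : NNReal) : ℝ) : ℂ) ^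
          (s - ((n : ℂ) - 1) / 2) := by
  -- adapted from `Hida2000Thm326.rsIntegrand_glDiagonal_fin_one` (`n = 2`)
  have hinv : (glDiagonal 1 F fun _ => a)⁻¹ = glDiagonal 1 F fun _ => a⁻¹ := by
    rw [← map_inv]; rfl
  rw [rsIntegrand, hinv, Literature.NumberTheory.EllipticCurves.Hida2000Thm326.det_glDiagonal_fin_one,
    Nat.cast_one]

/-- **stub S1 (the `(n, 1)` Rankin–Selberg zeta integral against a constant `W'` is the corner-torus
integral).**  For the measure `ν` on `GL₁(F) ⧸ U₁` transported from a Haar measure `μ'` of `Fˣ`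
(`hint`, as produced by `exists_haar_measure_quotient_fin_one`) and `W'` constant `= κ`:
`Ψ(s; W, W') = ∫_{Fˣ} W(diag(a, 1_{n-1})) κ |a|^{s - (n-1)/2} dμ'(a)` (rank-`n` form of
`rsZeta_eq_integral_torus` of `WhittakerTorusJacquetGL2`: `rsKernel_mk_of_fin_one`, `rsIntegrand`,
`a ↦ a⁻¹` by `integral_inv_eq_self`). [cite: JacquetPiatetskiShapiroShalika1983, §2.4]
[cite: CogdellAnalyticTheory2004, §6.1] -/
theorem stub_rsZeta_fin_one_eq_integral_corner :
    ∀ (F : Type) [Field F] [ValuativeRel F] [TopologicalSpace F] [IsNonarchimedeanLocalField F]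
      [MeasurableSpace F] [BorelSpace F] (n : ℕ) (hn : 1 < n)
      [MeasurableSpace (GL (Fin 1) F ⧸ upperUnitriangular (Fin 1) F)]
      (μ' : MeasureTheory.Measure Fˣ) [μ'.IsHaarMeasure]
      (ν : MeasureTheory.Measure (GL (Fin 1) F ⧸ upperUnitriangular (Fin 1) F)),
      (∀ f : GL (Fin 1) F ⧸ upperUnitriangular (Fin 1) F → ℂ,
        ∫ x, f x ∂ν = ∫ a : Fˣ, f (QuotientGroup.mk (glDiagonal 1 F fun _ => a)) ∂μ') →
      ∀ (W : GL (Fin n) F → ℂ) (W' : GL (Fin 1) F → ℂ) (κ : ℂ), (∀ g, W' g = κ) → ∀ s : ℂ,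
        rsZeta hn ν W W' s =
          ∫ a : Fˣ, W (glCorner F hn.le (glDiagonal 1 F fun _ => a)) * κ *
            (((IsNonarchimedeanLocalField.normAbs F (a : F) : NNReal) : ℝ) : ℂ) ^
              (s - ((n : ℂ) - 1) / 2) ∂μ' := by
  -- adapted from `Literature.NumberTheory.Automorphic.rsZeta_eq_integral_torus` (`n = 2`)
  intro F _ _ _ _ _ _ n hn _ μ' _ ν hint W W' κ hW' s
  haveI : T2Space F :=
    (Literature.NumberTheory.GaloisRepresentations.IsNonarchimedeanLocalField.isLocalField F).toT2Space
  haveI : BorelSpace Fˣ := Units.borelSpace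
  haveI := isInvInvariant_of_isHaarMeasure_units μ'
  have hker : ∀ a : Fˣ, rsKernel hn W W' s (QuotientGroup.mk (glDiagonal 1 F fun _ => a)) =
      W (glCorner F hn.le (glDiagonal 1 F fun _ => a⁻¹)) * κ *
        (((IsNonarchimedeanLocalField.normAbs F ((a⁻¹ : Fˣ) : F) : NNReal) : ℝ) : ℂ) ^
          (s - ((n : ℂ) - 1) / 2) := by
    intro a
    rw [rsKernel_mk_of_fin_one, rsIntegrand_glDiagonal_fin_one_corner, hW']
  rw [rsZeta, hint]
  simp_rw [hker]
  exact integral_inv_eq_self (fun a : Fˣ => W (glCorner F hn.le (glDiagonal 1 F fun _ => a)) * κ *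
    (((IsNonarchimedeanLocalField.normAbs F (a : F) : NNReal) : ℝ) : ℂ) ^ (s - ((n : ℂ) - 1) / 2)) μ'

end Summit.Langlands.Langlands.Theorems.ReciprocityUpToIrreducibility
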